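import Literature.Probability.LatticeModels.PolygonWordCounting
import HarnessLib

/-!
# The word of a lattice polygon, IV: the Bernoulli marginal and lattice exactness

Last of four files of the label-based (`Site 2 × Fin 2`) proof of row-transfer exactness for the
word of a lattice polygon (`PercolationPolygonWord.lean`; support item `RowTransferExactness` of
route `CriticalPhenomena/CardyPolygonWords`). The named fact
`Literature.Probability.LatticeModels.RowTransferExactness` itself was discharged independently
and concurrently in `PercolationPolygonWordProofs.lean` (`RowTransferExactness_holds`, via the
random row state `partRec` and a spectator-cylinder induction); it is NOT restated here. This
file completes the `PolygonWord` series with the results that are reusable beyond that fact: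

* `bondOf`: the bond of `ℤ²` carrying a label (injective, lands in the edge set);
  `labelsOfConfig ω`: the open labels of a bond configuration; `cyl L A`: the cylinder event "on
  the labels `L` exactly the bonds of `A` are open".
* `bondPercolation_cyl`: under `bondPercolation (zdGraph 2) half = setBer(E(ℤ²), 1/2)` (Mathlib's
  product Bernoulli measure) every cylinder on `|L|` labelled bonds has probability `2^{-|L|}`
  (`setBernoulli_apply'`, `Measure.infinitePi_pi`); hence **probabilities of local events are
  counts** (`bondPercolation_real_setOf_eq_card`: if `P` depends only on the labels in `L`, then
  `P_{1/2}(P) = 2^{-|L|} · #{A ⊆ L | P A}`) — a counting interface to `P_{1/2}` usable for any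
  finitely supported percolation event.
* `bondPercolation_real_crossing_eq_latticeWordAmplitude`: the LATTICE form of exactness — for
  ANY finite `V ⊆ ℤ²` whose rows lie in `(b, b + n]` and any wire sets, `P_{1/2}`(some vertex of
  `V ∩ W_A` is joined to `V ∩ W_B` by an open path of the subgraph of `ℤ²` induced on `V`)
  `= latticeWordAmplitude V W_A W_B b n` (combining the deterministic read-out
  `starsJoined_detState_iff` of file II with the counting identity
  `latticeWordAmplitude_eq_average` of file III).
* `openGraph_inf_discreteDomainGraph_polyomino`: at an aligned mesh the G02 graph
  `openGraph ω ⊓ discreteDomainGraph Ω δ` of an open polyomino IS the induced open subgraph read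
  through the labels (`discreteDomainGraph_adj_iff_polyomino`), and
  `discreteCrossingProb_polyomino_eq`: `discreteCrossingProb half Ω (δ₀/N) A B` equals the lattice
  crossing amplitude of `Ω_δ` wired along the discrete arcs of ANY two boundary sets `A`, `B`
  (from which `RowTransferExactness` is the special case `A = R.arc 0`, `B = R.arc 2` after
  rewriting `R.carrier`; see `RowTransferExactness_holds`).

Sources: Cardy, arXiv:math-ph/0103018, §7.1 (`P = ⟨a| e^{-WH} |b⟩`); Bondesan–Jacobsen–Saleur,
arXiv:1207.7005, §5; the identities for the G02 discretisation are folklore bookkeeping.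
-/

noncomputable section

open Finset SimpleGraph
open scoped Classical

namespace Literature.Probability.LatticeModels

namespace PolygonWord

/-! ### The Bernoulli marginal on finitely many bonds -/

section Bernoulli

open _root_.MeasureTheory _root_.ProbabilityTheory unitInterval
open scoped ENNReal

/-- The bond of `ℤ²` carrying the label `l`: `(v, 0) ↦ {v - e₁, v}`, `(v, 1) ↦ {v, v + e₀}`.
[folklore] -/
def bondOf (l : Site 2 × Fin 2) : Sym2 (Site 2) :=
  if l.2 = 0 then s(l.1 - unitVec 1, l.1) else s(l.1, l.1 + unitVec 0)

/-- The vertical bond of a label. [folklore] -/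
theorem bondOf_zero (v : Site 2) : bondOf (v, 0) = s(v - unitVec 1, v) := by simp [bondOf]

/-- The horizontal bond of a label. [folklore] -/
theorem bondOf_one (v : Site 2) : bondOf (v, 1) = s(v, v + unitVec 0) := by simp [bondOf]

/-- Labelled bonds are edges of `ℤ²`. [folklore] -/
theorem bondOf_mem_edgeSet (l : Site 2 × Fin 2) : bondOf l ∈ (zdGraph 2).edgeSet := by
  obtain ⟨v, j⟩ := l
  fin_cases j
  · simp only [Fin.zero_eta, bondOf_zero]
    have h := Percolation.single_edge_mem (v - unitVec 1) 1
    rwa [sub_add_cancel] at h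
  · simp only [Fin.mk_one, bondOf_one]
    exact Percolation.single_edge_mem v 0

/-- The labelling of bonds is injective. [folklore] -/
theorem bondOf_injective : Function.Injective bondOf := by
  rintro ⟨v, j⟩ ⟨v', j'⟩ h
  fin_cases j <;> fin_cases j'
  · simp only [Fin.zero_eta, bondOf_zero, Sym2.eq_iff] at h
    rcases h with ⟨-, rfl⟩ | ⟨h1, h2⟩
    · rfl
    · have e1 := congrFun h1 1
      have e2 := congrFun h2 1
      simp at e1 e2
      omega
  · simp only [Fin.zero_eta, Fin.mk_one, bondOf_zero, bondOf_one, Sym2.eq_iff] at h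
    rcases h with ⟨h1, h2⟩ | ⟨h1, h2⟩
    · have e1 := congrFun h1 1
      have e2 := congrFun h2 1
      simp at e1 e2
      omega
    · have e1 := congrFun h1 1
      have e2 := congrFun h2 1
      simp at e1 e2
      omega
  · simp only [Fin.zero_eta, Fin.mk_one, bondOf_zero, bondOf_one, Sym2.eq_iff] at h
    rcases h with ⟨h1, h2⟩ | ⟨h1, h2⟩
    · have e1 := congrFun h1 1
      have e2 := congrFun h2 1
      simp at e1 e2
      omega
    · have e1 := congrFun h1 1
      have e2 := congrFun h2 1
      simp at e1 e2
      omega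
  · simp only [Fin.mk_one, bondOf_one, Sym2.eq_iff] at h
    rcases h with ⟨rfl, -⟩ | ⟨h1, h2⟩
    · rfl
    · have e1 := congrFun h1 0
      have e2 := congrFun h2 0
      simp at e1 e2
      omega

/-- The open bond labels of a bond configuration `ω`. [folklore] -/
def labelsOfConfig (ω : Set (Sym2 (Site 2))) : Set (Site 2 × Fin 2) := {l | bondOf l ∈ ω}

/-- Membership in `labelsOfConfig`. [folklore] -/
@[simp] theorem mem_labelsOfConfig (ω : Set (Sym2 (Site 2))) (l : Site 2 × Fin 2) :
    l ∈ labelsOfConfig ω ↔ bondOf l ∈ ω :=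
  Iff.rfl

/-- The cylinder event: on the labels `L`, exactly the bonds of `A` are open. [folklore] -/
def cyl (L A : Finset (Site 2 × Fin 2)) : Set (Set (Sym2 (Site 2))) :=
  {ω | ∀ l ∈ L, bondOf l ∈ ω ↔ l ∈ A}

/-- Cylinder events are measurable. [folklore] -/
theorem measurableSet_cyl (L A : Finset (Site 2 × Fin 2)) : MeasurableSet (cyl L A) := by
  have h : cyl L A = ⋂ l ∈ L, {ω | bondOf l ∈ ω ↔ l ∈ A} := by
    ext ω
    simp [cyl]
  rw [h]
  exact Finset.measurableSet_biInter L fun l _ =>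
    measurableSet_setOf.2 ((measurable_set_mem _).iff measurable_const)

/-- One Bernoulli(1/2) factor: the coordinate measure of `setBer(E, 1/2)` at an edge gives mass
`1/2` to "open iff `c`", whatever `c`. [folklore] -/
theorem bernoulliHalf_factor {e : Sym2 (Site 2)} (he : e ∈ (zdGraph 2).edgeSet) (c : Prop) :
    (toNNReal Percolation.half • Measure.dirac (e ∈ (zdGraph 2).edgeSet) +
      toNNReal (σ Percolation.half) • Measure.dirac False) {q : Prop | q ↔ c} = 2⁻¹ := by
  have h1 : toNNReal Percolation.half = 2⁻¹ := by
    apply NNReal.eq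
    show ((Percolation.half : I) : ℝ) = ((2⁻¹ : NNReal) : ℝ)
    simp [Percolation.half]
  have h2 : toNNReal (σ Percolation.half) = 2⁻¹ := by
    apply NNReal.eq
    show ((σ Percolation.half : I) : ℝ) = ((2⁻¹ : NNReal) : ℝ)
    rw [unitInterval.coe_symm_eq]
    simp [Percolation.half]
    norm_num
  have he' : (e ∈ (zdGraph 2).edgeSet) = True := eq_true he
  rw [Measure.add_apply, Measure.smul_apply, Measure.smul_apply, Measure.dirac_apply,
    Measure.dirac_apply, h1, h2, he']
  by_cases hc : c
  · have hT : True ∈ {q : Prop | q ↔ c} := by simp [hc]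
    have hF : False ∉ {q : Prop | q ↔ c} := by simp [hc]
    rw [Set.indicator_of_mem hT, Set.indicator_of_notMem hF]
    simp
  · have hT : True ∉ {q : Prop | q ↔ c} := by simp [hc]
    have hF : False ∈ {q : Prop | q ↔ c} := by simp [hc]
    rw [Set.indicator_of_notMem hT, Set.indicator_of_mem hF]
    simp

/-- **The Bernoulli(1/2) marginal**: each cylinder on `|L|` labelled bonds has probability
`2^{-|L|}`. [folklore] -/
theorem bondPercolation_cyl (L A : Finset (Site 2 × Fin 2)) :
    Percolation.bondPercolation (zdGraph 2) Percolation.half (cyl L A) = (2⁻¹ : ℝ≥0∞) ^ L.card := by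
  rw [Percolation.bondPercolation, setBernoulli_apply']
  have hpre : (fun p : Sym2 (Site 2) → Prop => {i | p i}) ⁻¹' cyl L A =
      Set.pi (↑(L.image bondOf)) (fun e => {q : Prop | q ↔ e ∈ A.image bondOf}) := by
    ext p
    simp only [cyl, Set.mem_preimage, Set.mem_setOf_eq, Set.mem_pi, Finset.coe_image,
      Set.forall_mem_image, Finset.mem_coe]
    refine forall₂_congr fun l _ => ?_
    rw [bondOf_injective.mem_finset_image]
  rw [hpre, Measure.infinitePi_pi _ (fun _ _ => MeasurableSpace.measurableSet_top),
    Finset.prod_image (fun l _ l' _ h => bondOf_injective h)]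
  rw [Finset.prod_congr rfl (fun l _ => bernoulliHalf_factor (bondOf_mem_edgeSet l) _),
    Finset.prod_const]

/-- The same in real numbers: `P(cyl L A) = (2 ^ |L|)⁻¹`. [folklore] -/
theorem bondPercolation_real_cyl (L A : Finset (Site 2 × Fin 2)) :
    (Percolation.bondPercolation (zdGraph 2) Percolation.half).real (cyl L A) = ((2 : ℝ) ^ L.card)⁻¹ := by
  rw [measureReal_def, bondPercolation_cyl, ENNReal.toReal_pow, ENNReal.toReal_inv]
  simp [inv_pow]

/-- **Probabilities of local events are counts.** If `P` only depends on the labels in `L`,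
then `P_{1/2}(P(open labels)) = 2^{-|L|} · #{A ⊆ L | P A}`. [folklore] -/
theorem bondPercolation_real_setOf_eq_card (L : Finset (Site 2 × Fin 2))
    (P : Set (Site 2 × Fin 2) → Prop)
    (hP : ∀ D D' : Set (Site 2 × Fin 2), (∀ l ∈ L, (l ∈ D ↔ l ∈ D')) → (P D ↔ P D')) :
    (Percolation.bondPercolation (zdGraph 2) Percolation.half).real {ω | P (labelsOfConfig ω)} =
      ((2 : ℝ) ^ L.card)⁻¹ *
        (L.powerset.filter fun A : Finset (Site 2 × Fin 2) => P (↑A : Set (Site 2 × Fin 2))).card := by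
  have hE : {ω | P (labelsOfConfig ω)} =
      ⋃ A ∈ L.powerset.filter (fun A : Finset (Site 2 × Fin 2) => P (↑A : Set (Site 2 × Fin 2))),
        cyl L A := by
    ext ω
    simp only [Set.mem_setOf_eq, Set.mem_iUnion, Finset.mem_filter, Finset.mem_powerset,
      exists_prop]
    constructor
    · intro hω
      refine ⟨L.filter (fun l => bondOf l ∈ ω), ⟨Finset.filter_subset _ _, ?_⟩, ?_⟩
      · refine (hP _ _ fun l hl => ?_).1 hω
        simp [hl]
      · intro l hl
        simp [hl]
    · rintro ⟨A, ⟨-, hPA⟩, hω⟩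
      refine (hP _ _ fun l hl => ?_).2 hPA
      rw [mem_labelsOfConfig, Finset.mem_coe]
      exact hω l hl
  rw [hE, measureReal_biUnion_finset]
  · rw [Finset.sum_congr rfl (fun A _ => bondPercolation_real_cyl L A), Finset.sum_const,
      nsmul_eq_mul, mul_comm]
  · intro A hA A' hA' hne
    rw [Function.onFun, Set.disjoint_left]
    intro ω h1 h2
    apply hne
    rw [Finset.mem_coe, Finset.mem_filter, Finset.mem_powerset] at hA hA'
    ext l
    constructor
    · intro hl
      exact (h2 l (hA.1 hl)).1 ((h1 l (hA.1 hl)).2 hl)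
    · intro hl
      exact (h1 l (hA'.1 hl)).1 ((h2 l (hA'.1 hl)).2 hl)
  · exact fun A _ => measurableSet_cyl L A

/-- **Lattice exactness.** For a finite vertex set `V ⊆ ℤ²` whose rows lie in the window
`(b, b + n]` and wire sets `W_A`, `W_B`, the `P_{1/2}`-probability that some vertex of `V ∩ W_A`
is joined to some vertex of `V ∩ W_B` by an open path of the subgraph of `ℤ²` induced on `V`
equals the word amplitude `latticeWordAmplitude V W_A W_B b n`. [folklore] -/
theorem bondPercolation_real_crossing_eq_latticeWordAmplitude (V : Finset (Site 2))
    (WA WB : Set (Site 2)) (b : ℤ) (n : ℕ) (hb : ∀ v ∈ V, b < v 1 ∧ v 1 ≤ b + n) :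
    (Percolation.bondPercolation (zdGraph 2) Percolation.half).real
      {ω | ∃ u, u ∈ V ∧ u ∈ WA ∧ ∃ v, v ∈ V ∧ v ∈ WB ∧
        (openInduced (labelsOfConfig ω) V).Reachable u v} =
    latticeWordAmplitude V WA WB b n := by
  have hev : {ω : Set (Sym2 (Site 2)) | ∃ u, u ∈ V ∧ u ∈ WA ∧ ∃ v, v ∈ V ∧ v ∈ WB ∧
        (openInduced (labelsOfConfig ω) V).Reachable u v} =
      {ω | (detState (labelsOfConfig ω) V ![WA, WB] b n).StarsJoined} := by
    ext ω
    rw [Set.mem_setOf_eq, Set.mem_setOf_eq, starsJoined_detState_iff b n hb]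
    rfl
  rw [hev, bondPercolation_real_setOf_eq_card (wordLabels V b n)
    (fun D => (detState D V ![WA, WB] b n).StarsJoined), latticeWordAmplitude_eq_average]
  intro D D' h
  rw [detState_congr V _ b n h]

end Bernoulli

/-! ### The polyomino glue and the exactness theorem -/

section Polyomino

open _root_.MeasureTheory

/-- Open polyominoes are bounded. [folklore] -/
theorem isBounded_polyominoCarrier (δ₀ : ℝ) (s : Finset (ℤ × ℤ)) :
    Bornology.IsBounded (polyominoCarrier δ₀ s) := by
  rw [polyominoCarrier_eq]
  refine Bornology.IsBounded.subset ?_ interior_subset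
  refine (Bornology.isBounded_biUnion_finset s).2 fun p _ => ?_
  rw [polyominoSquare_eq_reProdIm]
  exact (Metric.isBounded_Icc _ _).reProdIm (Metric.isBounded_Icc _ _)

/-- **At an aligned mesh, the open part of the discrete domain graph of a lattice polygon is the
open subgraph of `ℤ²` induced on the discrete domain, read through the bond labels.**
[folklore] -/
theorem openGraph_inf_discreteDomainGraph_polyomino {δ₀ : ℝ} {s : Finset (ℤ × ℤ)} {N : ℕ}
    (hδ₀ : 0 < δ₀) (hN : 0 < N) (ω : Set (Sym2 (Site 2))) :
    Percolation.openGraph ω ⊓ discreteDomainGraph (polyominoCarrier δ₀ s) (δ₀ / N) =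
      openInduced (labelsOfConfig ω) (meshDomainFinset (polyominoCarrier δ₀ s) (δ₀ / N)) := by
  have hδ : 0 < δ₀ / N := div_pos hδ₀ (by exact_mod_cast hN)
  have hV : ∀ u, u ∈ meshDomainFinset (polyominoCarrier δ₀ s) (δ₀ / N) ↔
      u ∈ meshDomain (polyominoCarrier δ₀ s) (δ₀ / N) := by
    intro u
    rw [← Finset.mem_coe, coe_meshDomainFinset (isBounded_polyominoCarrier δ₀ s) hδ]
  ext u v
  rw [SimpleGraph.inf_adj, Percolation.openGraph_adj, discreteDomainGraph_adj_iff_polyomino hδ₀ hN,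
    openInduced, SimpleGraph.fromRel_adj, zdGraph_adj_iff, Fin.exists_fin_two]
  simp only [inRel, hV, mem_labelsOfConfig, bondOf_zero, bondOf_one]
  have e0 : ∀ w : Site 2, w + Pi.single (0 : Fin 2) (1 : ℤ) = w + unitVec 0 := fun w => rfl
  have e1 : ∀ w : Site 2, w + Pi.single (1 : Fin 2) (1 : ℤ) = w + unitVec 1 := fun w => rfl
  simp only [e0, e1]
  constructor
  · rintro ⟨⟨hω, hne⟩, (h | h) | (h | h), hu, hv⟩
    · -- `v = u + e₀`
      refine ⟨hne, Or.inl ⟨hu, hv, Or.inr ⟨h, ?_⟩⟩⟩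
      rwa [h] at hω
    · -- `u = v + e₀`
      refine ⟨hne, Or.inr ⟨hv, hu, Or.inr ⟨h, ?_⟩⟩⟩
      rwa [h, Sym2.eq_swap] at hω
    · -- `v = u + e₁`
      refine ⟨hne, Or.inl ⟨hu, hv, Or.inl ⟨h, ?_⟩⟩⟩
      rwa [h, add_sub_cancel_right, ← h]
    · -- `u = v + e₁`
      refine ⟨hne, Or.inr ⟨hv, hu, Or.inl ⟨h, ?_⟩⟩⟩
      rw [Sym2.eq_swap] at hω
      rwa [h, add_sub_cancel_right, ← h]
  · rintro ⟨hne, ⟨hu, hv, ⟨h, hω⟩ | ⟨h, hω⟩⟩ | ⟨hv, hu, ⟨h, hω⟩ | ⟨h, hω⟩⟩⟩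
    · rw [h, add_sub_cancel_right, ← h] at hω
      exact ⟨⟨hω, hne⟩, Or.inr (Or.inl h), hu, hv⟩
    · rw [← h] at hω
      exact ⟨⟨hω, hne⟩, Or.inl (Or.inl h), hu, hv⟩
    · rw [h, add_sub_cancel_right, ← h, Sym2.eq_swap] at hω
      exact ⟨⟨hω, hne⟩, Or.inr (Or.inr h), hu, hv⟩
    · rw [← h, Sym2.eq_swap] at hω
      exact ⟨⟨hω, hne⟩, Or.inl (Or.inr h), hu, hv⟩

/-- **Exactness for lattice polygons, arc version.** For the open polyomino `Ω` of `δ₀`-squares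
and an aligned mesh `δ = δ₀ / N`, the `P_{1/2}` crossing probability of the G02 discrete domain
`Ω_δ` between the discrete arcs of ANY two boundary sets `A`, `B` equals the lattice crossing
amplitude of `Ω_δ` wired along these discrete arcs. [folklore] -/
theorem discreteCrossingProb_polyomino_eq {δ₀ : ℝ} {s : Finset (ℤ × ℤ)} {N : ℕ}
    (hδ₀ : 0 < δ₀) (hN : 0 < N) (A B : Set ℂ) :
    Percolation.discreteCrossingProb Percolation.half (polyominoCarrier δ₀ s) (δ₀ / N) A B =
      latticeCrossingAmplitude (meshDomainFinset (polyominoCarrier δ₀ s) (δ₀ / N))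
        (discreteArc (polyominoCarrier δ₀ s) (δ₀ / N) A)
        (discreteArc (polyominoCarrier δ₀ s) (δ₀ / N) B) := by
  have hδ : 0 < δ₀ / N := div_pos hδ₀ (by exact_mod_cast hN)
  set Ω := polyominoCarrier δ₀ s with hΩ
  set V := meshDomainFinset Ω (δ₀ / N) with hVdef
  have hV : ∀ u, u ∈ V ↔ u ∈ meshDomain Ω (δ₀ / N) := by
    intro u
    rw [← Finset.mem_coe, hVdef, coe_meshDomainFinset (isBounded_polyominoCarrier δ₀ s) hδ]
  have harc : ∀ (C : Set ℂ) {x : Site 2}, x ∈ discreteArc Ω (δ₀ / N) C → x ∈ V := fun C x hx =>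
    (hV x).2 (meshBoundary_subset_meshDomain _ _ (discreteArc_subset_meshBoundary _ _ _ hx))
  unfold Percolation.discreteCrossingProb latticeCrossingAmplitude
  rw [← bondPercolation_real_crossing_eq_latticeWordAmplitude V _ _ (wordBaseRow V) (wordRowCount V)
    (fun v hv => wordBaseRow_lt_and_le hv)]
  congr 1
  ext ω
  have hG : Percolation.openGraph ω ⊓ discreteDomainGraph Ω (δ₀ / N) =
      openInduced (labelsOfConfig ω) V :=
    openGraph_inf_discreteDomainGraph_polyomino hδ₀ hN ω
  simp only [Percolation.discreteCrossing, Set.mem_setOf_eq]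
  constructor
  · rintro ⟨x, hx, y, hy, h⟩
    exact ⟨x, harc A hx, hx, y, harc B hy, hy, h.mono hG.le⟩
  · rintro ⟨x, -, hx, y, -, hy, h⟩
    exact ⟨x, hx, y, hy, h.mono hG.ge⟩

end Polyomino

end PolygonWord

end Literature.Probability.LatticeModels

end
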